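import Mathlib
import Literature.AlgebraicGeometry.Resolution.WeightedOrderChainLaw
import Literature.AlgebraicGeometry.Resolution.RsopAdaptedShift
import HarnessLib

/-!
# Following an infinite chain of adapted near points: the corrected coordinates

Topic: `Literature/AlgebraicGeometry/Resolution`. Ring-level recursion behind the "standard
arguments" of the termination proof of Cossart–Piltant 2008, Prop. 4.4 (p. 11, case `τ = 2`:
"there exists a regular (possibly formal) curve `Γ` such that `x_{σ(i)}` belongs to the strict
transform of `Γ` for `i ≥ i₁`"). Data: regular local rings `R_n` of embedding dimension `3`,
ring maps `φ_n : R_n → R_{n+1}`, ideals `I_n ⊆ 𝔪_n^μ`, a fixed index `j`, and the STEP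
property (supplied by the geometry of a `τ = 2` near point over an adapted one:
`NearPointForcedChart`, `NearPointDirectrixGraph`, `RsopAdaptedShift`): every ADAPTED regular
system of parameters `c` of `R_n` has a transform `c′` in `R_{n+1}` (`c′_j = φ c_j`,
`φ c_i = φ c_j · c′_i`, `(I_n R_{n+1} : c′_j^μ) ⊆ I_{n+1}`) which becomes adapted after a shift
`c′_i ↦ c′_i − a_i c′_j` by ANY lifts `a_i` of prescribed residues `λ_i`. If moreover every
residue field `k(R_n)` is reached from `R_0` (the near points are rational), then starting from an
adapted `c⁽⁰⁾` of `R_0` we construct level-`0` corrected coordinates `z⁽ᴺ⁾` (`z⁽⁰⁾ = c⁽⁰⁾`,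
`z⁽ᴺ⁺¹⁾ − z⁽ᴺ⁾ ∈ (c_j^{N+2})`, `z⁽ᴺ⁾_j = c_j`) with
**`I_0 ⊆ (z⁽ᴺ⁾_{i₁}, z⁽ᴺ⁾_{i₂})^μ + (c_j^{N+2})`** for all `N` (`exists_corrected_coordinates`) —
exactly the input of `FormalAxisOfNearChain.exists_prime_ne_maximalIdeal_map_le_pow`.

## Sources

* V. Cossart, O. Piltant, J. Algebra 320 (2008), proof of Prop. 4.4, p. 11. [CossartPiltant2008]
* H. Hironaka, *Characteristic polyhedra of singularities*, J. Math. Kyoto Univ. 7 (1967). [Hironaka1967]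
-/

noncomputable section

open IsLocalRing

namespace Literature.AlgebraicGeometry.Resolution

universe u

section Chain

variable {Rn : ℕ → Type u} [∀ n, CommRing (Rn n)] [∀ n, IsRegularLocalRing (Rn n)]
  (φ : ∀ n, Rn n →+* Rn (n + 1)) (I : ∀ n, Ideal (Rn n)) (μ : ℕ) (j : Fin 3)

/-- The composite `Φ_n = φ_{n−1} ∘ ⋯ ∘ φ_0 : R_0 → R_n`. [folklore] -/
def compHom : ∀ n, Rn 0 →+* Rn n
  | 0 => RingHom.id _
  | n + 1 => (φ n).comp (compHom n)

omit [∀ n, IsRegularLocalRing (Rn n)] in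
/-- `Φ_0 = id`. [folklore] -/
@[simp] theorem compHom_zero : compHom φ 0 = RingHom.id _ := rfl

omit [∀ n, IsRegularLocalRing (Rn n)] in
/-- `Φ_{n+1} = φ_n ∘ Φ_n`. [folklore] -/
theorem compHom_succ (n : ℕ) (r : Rn 0) : compHom φ (n + 1) r = φ n (compHom φ n r) := rfl

/-- **Residue fields along the chain are reached from `R_0`** when each `φ_n` is local and
induces a surjection `R_n → k(R_{n+1})` (rational near points). [folklore] -/
theorem residue_compHom_surjective [∀ n, IsLocalHom (φ n)]
    (hφ : ∀ n, Function.Surjective ((residue (Rn (n + 1))).comp (φ n))) (n : ℕ)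
    (t : ResidueField (Rn n)) : ∃ r : Rn 0, residue _ (compHom φ n r) = t := by
  induction n with
  | zero => obtain ⟨r, rfl⟩ := residue_surjective t; exact ⟨r, rfl⟩
  | succ n ih =>
    obtain ⟨rn, hrn⟩ := hφ n t
    obtain ⟨r0, hr0⟩ := ih (residue _ rn)
    refine ⟨r0, ?_⟩
    rw [compHom_succ, ← hrn, RingHom.comp_apply, ← sub_eq_zero, ← map_sub, residue_eq_zero_iff,
      ← map_sub]
    refine map_nonunit (φ n) _ ?_
    rw [← residue_eq_zero_iff, map_sub, sub_eq_zero, hr0]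

/-- **The STEP property** at level `n` for an adapted system `c`: the transformed system `c′`,
the weak-transform containment, and re-adaptation by shifts with prescribed residues.
[cite: CossartPiltant2008, proof of Lemma 4.3 (3) and (12)] -/
structure StepData (n : ℕ) (c : Fin 3 → Rn n) where
  /-- the transformed parameters at level `n + 1` -/
  c' : Fin 3 → Rn (n + 1)
  span_c' : Ideal.span (Set.range c') = maximalIdeal (Rn (n + 1))
  c'_self : c' j = φ n (c j)
  rel : ∀ i, i ≠ j → φ n (c i) = φ n (c j) * c' i
  weak : ∀ g : Rn (n + 1), φ n (c j) ^ μ * g ∈ (I n).map (φ n) → g ∈ I (n + 1)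
  /-- the residues of the re-adapting shift -/
  lam : {i : Fin 3 // i ≠ j} → ResidueField (Rn (n + 1))
  adapted_shift : ∀ a : {i : Fin 3 // i ≠ j} → Rn (n + 1), (∀ i, residue _ (a i) = lam i) →
    IsAdapted (shiftRsop c' j a) (I (n + 1)) μ j

/-- The clauses of a corrected chain of depth `N` with level-`0` coordinates `y` and level
coordinates `cs`. [folklore] -/
structure ChainOKWith (N : ℕ) (y : Fin 3 → Rn 0) (cs : ∀ n, Fin 3 → Rn n) : Prop where
  cs_zero : cs 0 = y
  span_cs : ∀ n, n ≤ N + 1 → Ideal.span (Set.range (cs n)) = maximalIdeal (Rn n)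
  adapted : ∀ n, n ≤ N → IsAdapted (cs n) (I n) μ j
  cs_self : ∀ n, n ≤ N → cs (n + 1) j = φ n (cs n j)
  rel : ∀ n, n ≤ N → ∀ i, i ≠ j → φ n (cs n i) = φ n (cs n j) * cs (n + 1) i
  weak : ∀ n, n ≤ N → ∀ g : Rn (n + 1), φ n (cs n j) ^ μ * g ∈ (I n).map (φ n) → g ∈ I (n + 1)
  shift : ∃ lam : {i : Fin 3 // i ≠ j} → ResidueField (Rn (N + 1)),
    ∀ a : {i : Fin 3 // i ≠ j} → Rn (N + 1), (∀ i, residue _ (a i) = lam i) →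
      IsAdapted (shiftRsop (cs (N + 1)) j a) (I (N + 1)) μ j

/-- A corrected chain of depth `N` with level-`0` coordinates `y` exists. [folklore] -/
def ChainOK (N : ℕ) (y : Fin 3 → Rn 0) : Prop :=
  ∃ cs : ∀ n, Fin 3 → Rn n, ChainOKWith φ I μ j N y cs

variable (hd : ∀ n, (maximalIdeal (Rn n)).spanFinrank = 3)
  (hstep : ∀ n (c : Fin 3 → Rn n), Ideal.span (Set.range c) = maximalIdeal (Rn n) →
    IsAdapted c (I n) μ j → Nonempty (StepData φ I μ j n c))
  (hres : ∀ n (t : ResidueField (Rn n)), ∃ r : Rn 0, residue _ (compHom φ n r) = t)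

/-! ## Base and step of the recursion -/

include hstep in
/-- Depth `0`. [folklore] -/
theorem chainOK_zero {c₀ : Fin 3 → Rn 0} (hc₀ : Ideal.span (Set.range c₀) = maximalIdeal (Rn 0))
    (had₀ : IsAdapted c₀ (I 0) μ j) : ChainOK φ I μ j 0 c₀ := by
  classical
  obtain ⟨S⟩ := hstep 0 c₀ hc₀ had₀
  -- level coordinates: `c₀` at `0`, `S.c'` at `1`, anything above
  let cs : ∀ n, Fin 3 → Rn n := fun n =>
    if h0 : n = 0 then h0 ▸ c₀ else if h1 : n = 1 then h1 ▸ S.c' else 0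
  have hcs0 : cs 0 = c₀ := rfl
  have hcs1 : cs 1 = S.c' := rfl
  refine ⟨cs, ⟨hcs0, ?_, ?_, ?_, ?_, ?_, ?_⟩⟩
  · intro n hn
    interval_cases n
    · rw [hcs0]; exact hc₀
    · rw [hcs1]; exact S.span_c'
  · intro n hn
    interval_cases n
    rw [hcs0]; exact had₀
  · intro n hn
    interval_cases n
    rw [hcs0, hcs1]; exact S.c'_self
  · intro n hn
    interval_cases n
    rw [hcs0, hcs1]; exact S.rel
  · intro n hn
    interval_cases n
    rw [hcs0]; exact S.weak
  · exact ⟨S.lam, fun a ha => by rw [hcs1]; exact S.adapted_shift a ha⟩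

include hd hstep hres in
/-- **Depth `N → N + 1`**: correct the level-`0` coordinates by `−ℓ_i c_j^{N+2}` with `ℓ_i`
lifting the residues of the re-adapting shift at level `N + 1` all the way down to `R_0`.
[cite: CossartPiltant2008, proof of Prop. 4.4, p. 11] -/
theorem chainOK_succ {N : ℕ} {y : Fin 3 → Rn 0} (h : ChainOK φ I μ j N y) :
    ∃ y' : Fin 3 → Rn 0, y' j = y j ∧ (∀ i, y' i - y i ∈ Ideal.span {y j ^ (N + 2)}) ∧
      ChainOK φ I μ j (N + 1) y' := by
  classical
  obtain ⟨cs, hcs⟩ := h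
  obtain ⟨lam, hlam⟩ := hcs.shift
  -- lifts `ℓ_i ∈ R_0` of `λ_i ∈ k(R_{N+1})`
  obtain ⟨ℓ, hℓ⟩ : ∃ ℓ : {i : Fin 3 // i ≠ j} → Rn 0,
      ∀ i, residue _ (compHom φ (N + 1) (ℓ i)) = lam i :=
    ⟨fun i => Classical.choose (hres (N + 1) (lam i)),
      fun i => Classical.choose_spec (hres (N + 1) (lam i))⟩
  -- `cs n j = Φ_n (y j)` for `n ≤ N + 1`
  have hcsj : ∀ n, n ≤ N + 1 → cs n j = compHom φ n (y j) := by
    intro n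
    induction n with
    | zero => intro _; rw [hcs.cs_zero]; rfl
    | succ n ih => intro hn; rw [hcs.cs_self n (by omega), ih (by omega), compHom_succ]
  -- the corrected level coordinates
  let a : ∀ n, {i : Fin 3 // i ≠ j} → Rn n := fun n i => compHom φ n (ℓ i) * cs n j ^ (N + 1 - n)
  let ct : ∀ n, Fin 3 → Rn n := fun n => shiftRsop (cs n) j (a n)
  have hct_self : ∀ n, ct n j = cs n j := fun n => shiftRsop_self _ _ _
  have hct_of_ne : ∀ n {i} (hi : i ≠ j),
      ct n i = cs n i - compHom φ n (ℓ ⟨i, hi⟩) * cs n j ^ (N + 1 - n) * cs n j := by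
    intro n i hi
    rw [show ct n i = shiftRsop (cs n) j (a n) i from rfl, shiftRsop_of_ne _ _ _ hi]
  -- the new top level from STEP at `N + 1` applied to the shifted (adapted) system
  have hctN1 : ct (N + 1) = shiftRsop (cs (N + 1)) j (fun i => compHom φ (N + 1) (ℓ i)) := by
    funext i
    by_cases hi : i = j
    · subst hi; rw [hct_self, shiftRsop_self]
    · rw [hct_of_ne _ hi, shiftRsop_of_ne _ _ _ hi, Nat.sub_self, pow_zero, mul_one]
  have hadN1 : IsAdapted (ct (N + 1)) (I (N + 1)) μ j := by
    rw [hctN1]; exact hlam _ hℓ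
  have hspanN1 : Ideal.span (Set.range (ct (N + 1))) = maximalIdeal _ := by
    rw [show ct (N + 1) = shiftRsop (cs (N + 1)) j (a (N + 1)) from rfl, span_range_shiftRsop]
    exact hcs.span_cs (N + 1) le_rfl
  obtain ⟨S⟩ := hstep (N + 1) (ct (N + 1)) hspanN1 hadN1
  let cs' : ∀ n, Fin 3 → Rn n := fun n =>
    if hle : n ≤ N + 1 then ct n else if heq : n = N + 2 then heq ▸ S.c' else 0
  have hcs'_le : ∀ n, n ≤ N + 1 → cs' n = ct n := fun n hn => dif_pos hn
  have hcs'_top : cs' (N + 2) = S.c' := by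
    change (if hle : N + 2 ≤ N + 1 then ct (N + 2) else _) = _
    rw [dif_neg (by omega), dif_pos rfl]
  -- perturbations at levels `≤ N` are in `𝔪²`
  have hpert : ∀ n, n ≤ N → ∀ i, ct n i - cs n i ∈ maximalIdeal (Rn n) ^ 2 := by
    intro n hn i
    by_cases hi : i = j
    · subst hi; rw [hct_self, sub_self]; exact Ideal.zero_mem _
    · rw [hct_of_ne n hi, sub_sub_cancel_left, Ideal.neg_mem_iff, mul_assoc, ← pow_succ]
      refine Ideal.mul_mem_left _ _ (Ideal.pow_le_pow_right (by omega) (Ideal.pow_mem_pow ?_ _))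
      rw [← hcs.span_cs n (by omega)]
      exact Ideal.subset_span ⟨j, rfl⟩
  refine ⟨ct 0, ?_, ?_, cs', ⟨(hcs'_le 0 (by omega)).trans rfl, ?_, ?_, ?_, ?_, ?_, ?_⟩⟩
  · rw [hct_self, hcs.cs_zero]
  · intro i
    rw [← hcs.cs_zero]
    by_cases hi : i = j
    · subst hi; rw [hct_self, sub_self]; exact Ideal.zero_mem _
    · rw [hct_of_ne 0 hi, sub_sub_cancel_left, Ideal.neg_mem_iff, mul_assoc, ← pow_succ,
        show N + 1 - 0 + 1 = N + 2 by omega]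
      exact Ideal.mul_mem_left _ _ (Ideal.subset_span rfl)
  · -- spans up to `N + 2`
    intro n hn
    rcases Nat.lt_or_ge n (N + 2) with hlt | hge
    · rw [hcs'_le n (by omega)]
      rcases Nat.lt_or_ge n (N + 1) with hlt' | hge'
      · exact span_range_eq_of_sub_mem_sq (hcs.span_cs n (by omega)) (hpert n (by omega))
      · obtain rfl : n = N + 1 := by omega
        exact hspanN1
    · obtain rfl : n = N + 2 := by omega
      rw [hcs'_top]; exact S.span_c'
  · -- adapted up to `N + 1`
    intro n hn
    rw [hcs'_le n hn]
    rcases Nat.lt_or_ge n (N + 1) with hlt | hge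
    · exact (hcs.adapted n (by omega)).of_sub_mem_sq (hd n) (hcs.span_cs n (by omega))
        (hpert n (by omega))
    · obtain rfl : n = N + 1 := by omega
      exact hadN1
  · -- `cs' (n+1) j = φ (cs' n j)`
    intro n hn
    rcases Nat.lt_or_ge n (N + 1) with hlt | hge
    · rw [hcs'_le n (by omega), hcs'_le (n + 1) (by omega), hct_self, hct_self]
      exact hcs.cs_self n (by omega)
    · obtain rfl : n = N + 1 := by omega
      rw [hcs'_top, hcs'_le _ le_rfl, S.c'_self]
  · -- relations
    intro n hn i hi
    rcases Nat.lt_or_ge n (N + 1) with hlt | hge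
    · rw [hcs'_le n (by omega), hcs'_le (n + 1) (by omega), hct_self, hct_of_ne n hi,
        hct_of_ne (n + 1) hi, map_sub, hcs.rel n (by omega) i hi, map_mul, map_mul, map_pow,
        ← compHom_succ, ← hcs.cs_self n (by omega),
        show N + 1 - n = (N + 1 - (n + 1)) + 1 by omega, pow_succ]
      ring
    · obtain rfl : n = N + 1 := by omega
      rw [hcs'_top, hcs'_le _ le_rfl]
      exact S.rel i hi
  · -- weak transforms
    intro n hn g hg
    rcases Nat.lt_or_ge n (N + 1) with hlt | hge
    · rw [hcs'_le n (by omega), hct_self] at hg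
      exact hcs.weak n (by omega) g hg
    · obtain rfl : n = N + 1 := by omega
      rw [hcs'_le _ le_rfl] at hg
      exact S.weak g hg
  · refine ⟨S.lam, fun a' ha' => ?_⟩
    have e : cs' (N + 1 + 1) = S.c' := hcs'_top
    rw [e]
    exact S.adapted_shift a' ha'

/-! ## Extraction and the recursion -/

omit [∀ n, IsRegularLocalRing (Rn n)] in
/-- Three distinct indices exhaust `Fin 3`. [folklore] -/
theorem insert_pair_eq_range {S : Type*} (f : Fin 3 → S) {i₁ i₂ : Fin 3} (h₁ : i₁ ≠ j) (h₂ : i₂ ≠ j)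
    (h₁₂ : i₁ ≠ i₂) : ({f j, f i₁, f i₂} : Set S) = Set.range f := by
  classical
  have huniv : ({j, i₁, i₂} : Finset (Fin 3)) = Finset.univ := by
    apply Finset.eq_univ_of_card
    rw [Finset.card_insert_of_notMem (by simp [Ne.symm h₁, Ne.symm h₂]), Finset.card_pair h₁₂]
    rfl
  ext r
  simp only [Set.mem_insert_iff, Set.mem_singleton_iff, Set.mem_range]
  constructor
  · rintro (rfl | rfl | rfl) <;> exact ⟨_, rfl⟩
  · rintro ⟨i, rfl⟩
    have hi : i ∈ ({j, i₁, i₂} : Finset (Fin 3)) := huniv ▸ Finset.mem_univ i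
    simp only [Finset.mem_insert, Finset.mem_singleton] at hi
    rcases hi with rfl | rfl | rfl
    · exact Or.inl rfl
    · exact Or.inr (Or.inl rfl)
    · exact Or.inr (Or.inr rfl)

include hd in
/-- **Extraction**: a corrected chain of depth `N` gives `I_0 ⊆ (y_{i₁}, y_{i₂})^μ + (y_j^{N+2})`
(the finite weighted-order chain law `le_pow_span_sup_of_nearChain`).
[cite: CossartPiltant2008, proof of Prop. 4.4, p. 11] -/
theorem le_of_chainOK (hIμ : ∀ n, I n ≤ maximalIdeal (Rn n) ^ μ) {N : ℕ} {y : Fin 3 → Rn 0}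
    (h : ChainOK φ I μ j N y) {i₁ i₂ : Fin 3} (h₁ : i₁ ≠ j) (h₂ : i₂ ≠ j) (h₁₂ : i₁ ≠ i₂) :
    I 0 ≤ Ideal.span {y i₁, y i₂} ^ μ ⊔ Ideal.span {y j ^ (N + 2)} := by
  obtain ⟨cs, hcs⟩ := h
  have hdim : ∀ n, ringKrullDim (Rn n) = 3 := fun n => by
    have := (isRegularLocalRing_iff (Rn n)).mp inferInstance
    rw [hd n] at this
    exact_mod_cast this.symm
  have key := le_pow_span_sup_of_nearChain φ (fun n => cs n j) (fun n => cs n i₁) (fun n => cs n i₂)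
    (N + 1) (fun n hn => by rw [insert_pair_eq_range j (cs n) h₁ h₂ h₁₂]; exact hcs.span_cs n hn)
    hdim I
    (fun n hn => (hcs.cs_self n (by omega)).symm)
    (fun n hn => by rw [hcs.rel n (by omega) i₁ h₁, hcs.cs_self n (by omega)])
    (fun n hn => by rw [hcs.rel n (by omega) i₂ h₂, hcs.cs_self n (by omega)])
    (fun n hn => hIμ n)
    (fun n hn g hg => hcs.weak n (by omega) g (by rw [← hcs.cs_self n (by omega)]; exact hg))
  rw [hcs.cs_zero] at key
  exact key

include hd hstep hres in
/-- **The corrected coordinates along an infinite chain of adapted near points**: starting from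
an adapted `c⁽⁰⁾`, there are level-`0` families `z⁽ᴺ⁾` with `z⁽⁰⁾ = c⁽⁰⁾`, `z⁽ᴺ⁾_j = c⁽⁰⁾_j`,
`z⁽ᴺ⁺¹⁾ − z⁽ᴺ⁾ ∈ 𝔪^{N+2}` and `I_0 ⊆ (z⁽ᴺ⁾_{i₁}, z⁽ᴺ⁾_{i₂})^μ + (c_j^{N+1})` for all `N`.
[cite: CossartPiltant2008, proof of Prop. 4.4, p. 11] -/
theorem exists_corrected_coordinates (hIμ : ∀ n, I n ≤ maximalIdeal (Rn n) ^ μ)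
    {c₀ : Fin 3 → Rn 0} (hc₀ : Ideal.span (Set.range c₀) = maximalIdeal (Rn 0))
    (had₀ : IsAdapted c₀ (I 0) μ j) {i₁ i₂ : Fin 3} (h₁ : i₁ ≠ j) (h₂ : i₂ ≠ j) (h₁₂ : i₁ ≠ i₂) :
    ∃ z : ℕ → Fin 3 → Rn 0, z 0 = c₀ ∧ (∀ N, z N j = c₀ j) ∧
      (∀ N i, z (N + 1) i - z N i ∈ maximalIdeal (Rn 0) ^ (N + 2)) ∧
      ∀ N, I 0 ≤ Ideal.span {z N i₁, z N i₂} ^ μ ⊔ Ideal.span {c₀ j ^ (N + 1)} := by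
  classical
  -- the recursion
  let seq : (N : ℕ) → {y : Fin 3 → Rn 0 // y j = c₀ j ∧ ChainOK φ I μ j N y} := fun N =>
    Nat.rec (motive := fun N => {y : Fin 3 → Rn 0 // y j = c₀ j ∧ ChainOK φ I μ j N y})
      ⟨c₀, rfl, chainOK_zero φ I μ j hstep hc₀ had₀⟩
      (fun N ih =>
        ⟨Classical.choose (chainOK_succ φ I μ j hd hstep hres ih.2.2),
          (Classical.choose_spec (chainOK_succ φ I μ j hd hstep hres ih.2.2)).1.trans ih.2.1,
          (Classical.choose_spec (chainOK_succ φ I μ j hd hstep hres ih.2.2)).2.2⟩) N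
  have hseq_succ : ∀ N, (seq (N + 1)).1 =
      Classical.choose (chainOK_succ φ I μ j hd hstep hres (seq N).2.2) := fun N => rfl
  refine ⟨fun N => (seq N).1, rfl, fun N => (seq N).2.1, fun N i => ?_, fun N => ?_⟩
  · have hspec := (Classical.choose_spec (chainOK_succ φ I μ j hd hstep hres (seq N).2.2)).2.1 i
    rw [← hseq_succ] at hspec
    rw [(seq N).2.1] at hspec
    refine Ideal.span_le.mpr ?_ hspec
    rw [Set.singleton_subset_iff, SetLike.mem_coe]
    exact Ideal.pow_mem_pow (hc₀ ▸ Ideal.subset_span ⟨j, rfl⟩) _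
  · have key := le_of_chainOK φ I μ j hd hIμ (seq N).2.2 h₁ h₂ h₁₂
    rw [(seq N).2.1] at key
    refine key.trans (sup_le_sup_left ?_ _)
    exact Ideal.span_singleton_le_span_singleton.mpr (pow_dvd_pow _ (by omega))

end Chain

end Literature.AlgebraicGeometry.Resolution

end
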